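import Literature.AlgebraicGeometry.AbelianSchemes.PolarizedAbelianSchemeWithLevel
import Literature.AlgebraicGeometry.AbelianSchemes.AbelianSchemeDualTransport
import Literature.AlgebraicGeometry.AbelianSchemes.RigidifiedLineBundleComap
import HarnessLib

/-!
# The unit hypothesis `𝒫|_{A × {ε_Â}} ≅ 𝒪` is TRANSPORTED along a cartesian chart `(G, Ĝ)` over `g : S′ → S`:
# `N_{D′} ≅ G^* N_D`, hence a base change of a normalised dual pair / triple is normalised

Layer `Literature/AlgebraicGeometry/AbelianSchemes`, namespaces `Literature.AlgebraicGeometry.AbelianSchemes.AbelianSchemeOver.DualPair`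
and `Literature.AlgebraicGeometry.AbelianSchemes.PolarizedAbelianSchemeWithLevel`.  THEOREMS ONLY.  Cell `hodgecm-mathlib` (D-0151),
the cross-base sibling of ★ `PoincareUnitHypothesisDescent` (which descends the hypothesis along `B ◁ ψ̂` over ONE base).

SETTING: abelian schemes `A / S`, `A′ / S′` with dual pairs `D = (Â, 𝒫)`, `D′ = (Â′, 𝒫′)` (★ `DualPair`: `𝒫` is normalised
along `ε_A × 1_Â` ONLY — the second normalisation `N_D := (1_A × ε_Â)^*𝒫 ≅ 𝒪_A` of [MumfordFogartyKirwan1994, Ch. 6 §2 (p. 121)]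
is the separate hypothesis `hD : Nonempty ((pullback (unitHatSlice D)).obj D.P ≅ 𝒪)` of ★ `AbelianSchemeDualTransport` §4, ★
`PoincareSheafBiadditive*`, ★ `DualIsogenyMulN`, …), a morphism `g : S′ → S`, and a chart `G : A′ → A`, `Ĝ : Â′ → Â` over `g`
with `Ĝ` preserving the unit sections (`ε_Â′ ≫ Ĝ = g ≫ ε_Â` — the unit clause of ★ `AbelianSchemeOver.IsBaseChangeVia`) and the
POINCARÉ CLAUSE `(G ×_g Ĝ)^*𝒫 ≅ 𝒫′` (verbatim the clause of ★ `PolarizedAbelianSchemeWithLevel.IsBaseChangeVia`,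
[MumfordFogartyKirwan1994, Def. 7.2]'s pull-back «in the obvious way»).  THEN
`(1_{A′} × ε_Â′) ≫ (G ×_g Ĝ) = G ≫ (1_A × ε_Â)` (both components: `1 ≫ G = G ≫ 1`, `π′ ≫ ε_Â′ ≫ Ĝ = π′ ≫ g ≫ ε_Â = G ≫ π ≫ ε_Â`), so
`N_{D′} = (1 × ε_Â′)^*𝒫′ ≅ (1 × ε_Â′)^*(G × Ĝ)^*𝒫 ≅ G^*(1 × ε_Â)^*𝒫 = G^*N_D`; in particular `N_D ≅ 𝒪 ⇒ N_{D′} ≅ G^*𝒪 ≅ 𝒪`: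
**a pull-back (in the sense of `IsBaseChangeVia`) of a triple whose Poincaré sheaf carries both normalisations again carries both.**
(The defect `N_D` is an invariant of the `IsBaseChangeVia`-class; cf. ★ `nonempty_unitHatSlice_baseChange_iso` for the CHOSEN
base change `D.baseChange g`, which this file generalises to any cartesian chart.)

* `unitHatSlice_comp_pullback_map` — `(1 × ε_Â′) ≫ (G × Ĝ) = G ≫ (1 × ε_Â)`;
* `nonempty_pullback_unitHatSlice_iso_pullback` — `N_{D′} ≅ G^*N_D`;
* `nonempty_unitHatSlice_iso_of_pullback_map_iso` — `N_D ≅ 𝒪 ⇒ N_{D′} ≅ 𝒪` (raw-clause form);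
* `nonempty_unitHatSlice_iso_of_hat_isBaseChangeVia` — the same with the unit clause read off `D′.hat.IsBaseChangeVia D.hat g Ĝ`;
* **`PolarizedAbelianSchemeWithLevel.IsBaseChangeVia.nonempty_unitHatSlice_iso`** — for triples: `P′.IsBaseChangeVia P f G Ĝ` and
  `N_{P.D} ≅ 𝒪` give `N_{P′.D} ≅ 𝒪`.

No named fact, no `sorry`, no instance, no notation.  HC_CM is proved only modulo the 7 printed citations until rung 0 closes;
nothing here is about HC.

## References
* [MumfordFogartyKirwan1994] D. Mumford, J. Fogarty, F. Kirwan, *Geometric Invariant Theory*, 3rd ed. (1994), Ch. 6 §2 (p. 121)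
  (the two normalisations of the Poincaré sheaf); Ch. 7 §2 Definition 7.2 (p. 129) (the pull-back functor).
* [MilneAV2008] J. S. Milne, *Abelian Varieties* (v2.00, 2008), I §8 pp. 36–37.
-/

noncomputable section

open CategoryTheory CategoryTheory.Limits AlgebraicGeometry MonoidalCategory CartesianMonoidalCategory
open scoped MonObj

universe u

-- `Scheme.Modules` / `SheafOfModules` are not reducible (as in Mathlib's `AlgebraicGeometry/Modules/Sheaf.lean`).
set_option backward.isDefEq.respectTransparency false

namespace Literature.AlgebraicGeometry.AbelianSchemes

namespace AbelianSchemeOver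

namespace DualPair

variable {S S' : Scheme.{u}} {A : AbelianSchemeOver S} {A' : AbelianSchemeOver S'} (D : A.DualPair) (D' : A'.DualPair)
  {g : S' ⟶ S} {G : A'.X.left ⟶ A.X.left} {Ĝ : D'.hat.X.left ⟶ D.hat.X.left}

/-- **`(1_{A′} × ε_Â′) ≫ (G ×_g Ĝ) = G ≫ (1_A × ε_Â)`** when `G` lies over `g` and `Ĝ` lies over `g` preserving the unit sections.
[cite: MumfordFogartyKirwan1994, Ch. 6 §2 (p. 121)] -/
theorem unitHatSlice_comp_pullback_map (wG : A'.X.hom ≫ g = G ≫ A.X.hom) (wĜ : D'.hat.X.hom ≫ g = Ĝ ≫ D.hat.X.hom)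
    (hε : D'.hat.unitSection ≫ Ĝ = g ≫ D.hat.unitSection) :
    unitHatSlice D' ≫ pullback.map A'.X.hom D'.hat.X.hom A.X.hom D.hat.X.hom G Ĝ g wG wĜ = G ≫ unitHatSlice D := by
  apply pullback.hom_ext
  · rw [Category.assoc, pullback.lift_fst, unitHatSlice_fst_assoc, Category.assoc, unitHatSlice_fst, Category.comp_id]
  · rw [Category.assoc, pullback.lift_snd, unitHatSlice_snd_assoc, Category.assoc, unitHatSlice_snd, hε,
      ← Category.assoc, wG, Category.assoc]

/-- **`N_{D′} ≅ G^* N_D`**: the restriction of `𝒫′` to `A′ × {ε_Â′}` is the pull-back along `G` of the restriction of `𝒫` to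
`A × {ε_Â}`, given the Poincaré clause `(G ×_g Ĝ)^*𝒫 ≅ 𝒫′` and `ε_Â′ ≫ Ĝ = g ≫ ε_Â`.
[cite: MumfordFogartyKirwan1994, Ch. 6 §2 (p. 121) and Ch. 7 §2 Definition 7.2 (p. 129)] -/
theorem nonempty_pullback_unitHatSlice_iso_pullback (wG : A'.X.hom ≫ g = G ≫ A.X.hom)
    (wĜ : D'.hat.X.hom ≫ g = Ĝ ≫ D.hat.X.hom) (hε : D'.hat.unitSection ≫ Ĝ = g ≫ D.hat.unitSection)
    (hP : Nonempty ((Scheme.Modules.pullback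
      (pullback.map A'.X.hom D'.hat.X.hom A.X.hom D.hat.X.hom G Ĝ g wG wĜ)).obj D.P ≅ D'.P)) :
    Nonempty ((Scheme.Modules.pullback (unitHatSlice D')).obj D'.P ≅
      (Scheme.Modules.pullback G).obj ((Scheme.Modules.pullback (unitHatSlice D)).obj D.P)) := by
  obtain ⟨e⟩ := hP
  exact ⟨(Scheme.Modules.pullback (unitHatSlice D')).mapIso e.symm ≪≫
    (Scheme.Modules.pullbackComp _ _).app D.P ≪≫
    (Scheme.Modules.pullbackCongr (unitHatSlice_comp_pullback_map D D' wG wĜ hε)).app D.P ≪≫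
    ((Scheme.Modules.pullbackComp _ _).app D.P).symm⟩

/-- **The second normalisation is TRANSPORTED**: if `(G ×_g Ĝ)^*𝒫 ≅ 𝒫′`, `ε_Â′ ≫ Ĝ = g ≫ ε_Â` and `𝒫|_{A × {ε_Â}} ≅ 𝒪`, then
`𝒫′|_{A′ × {ε_Â′}} ≅ 𝒪` (`N_{D′} ≅ G^*N_D ≅ G^*𝒪 ≅ 𝒪`, ★ `RigidifiedLineBundle.pullbackUnitIso`).
[cite: MumfordFogartyKirwan1994, Ch. 6 §2 (p. 121) and Ch. 7 §2 Definition 7.2 (p. 129)] [cite: MilneAV2008, I §8 pp. 36–37] -/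
theorem nonempty_unitHatSlice_iso_of_pullback_map_iso (wG : A'.X.hom ≫ g = G ≫ A.X.hom)
    (wĜ : D'.hat.X.hom ≫ g = Ĝ ≫ D.hat.X.hom) (hε : D'.hat.unitSection ≫ Ĝ = g ≫ D.hat.unitSection)
    (hP : Nonempty ((Scheme.Modules.pullback
      (pullback.map A'.X.hom D'.hat.X.hom A.X.hom D.hat.X.hom G Ĝ g wG wĜ)).obj D.P ≅ D'.P))
    (hD : Nonempty ((Scheme.Modules.pullback (unitHatSlice D)).obj D.P ≅ SheafOfModules.unit _)) :
    Nonempty ((Scheme.Modules.pullback (unitHatSlice D')).obj D'.P ≅ SheafOfModules.unit _) := by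
  obtain ⟨i⟩ := nonempty_pullback_unitHatSlice_iso_pullback D D' wG wĜ hε hP
  obtain ⟨r⟩ := hD
  exact ⟨i ≪≫ (Scheme.Modules.pullback G).mapIso r ≪≫ RigidifiedLineBundle.pullbackUnitIso G⟩

/-- **The second normalisation is transported along a base change of the duals AS GROUP SCHEMES**: the unit clause
`ε_Â′ ≫ Ĝ = g ≫ ε_Â` and `Ĝ` lying over `g` are read off `D′.hat.IsBaseChangeVia D.hat g Ĝ` (★ `AbelianSchemeOver.IsBaseChangeVia`).
[cite: MumfordFogartyKirwan1994, Ch. 6 §2 (p. 121) and Ch. 7 §2 Definition 7.2 (p. 129)] [cite: MilneAV2008, I §8 pp. 36–37] -/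
theorem nonempty_unitHatSlice_iso_of_hat_isBaseChangeVia (hĜ : D'.hat.IsBaseChangeVia D.hat g Ĝ)
    (wG : A'.X.hom ≫ g = G ≫ A.X.hom)
    (hP : Nonempty ((Scheme.Modules.pullback
      (pullback.map A'.X.hom D'.hat.X.hom A.X.hom D.hat.X.hom G Ĝ g wG hĜ.1.symm)).obj D.P ≅ D'.P))
    (hD : Nonempty ((Scheme.Modules.pullback (unitHatSlice D)).obj D.P ≅ SheafOfModules.unit _)) :
    Nonempty ((Scheme.Modules.pullback (unitHatSlice D')).obj D'.P ≅ SheafOfModules.unit _) := by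
  exact nonempty_unitHatSlice_iso_of_pullback_map_iso D D' wG hĜ.1.symm hĜ.2.2.1 hP hD

end DualPair

end AbelianSchemeOver

namespace PolarizedAbelianSchemeWithLevel

variable {g N : ℕ} {δ : Fin g → ℕ}

/-- **A pull-back of a triple whose Poincaré sheaf carries the second normalisation `𝒫|_{X × {ε_X̂}} ≅ 𝒪` carries it again**:
from `P′.IsBaseChangeVia P f G Ĝ` ([MumfordFogartyKirwan1994, Def. 7.2]'s pull-back relation: `Ĝ` preserves the unit sections,
and `(G ×_f Ĝ)^*𝒫 ≅ 𝒫′`) and `N_{P.D} ≅ 𝒪` follows `N_{P′.D} ≅ 𝒪` (any bases; no Noetherian / reducedness hypothesis) — the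
second normalisation of [MumfordFogartyKirwan1994, Ch. 6 §2 (p. 121)] is an invariant of the pull-back class.
[cite: MumfordFogartyKirwan1994, Ch. 6 §2 (p. 121) and Ch. 7 §2 Definition 7.2 (p. 129)] [cite: MilneAV2008, I §8 pp. 36–37] -/
theorem IsBaseChangeVia.nonempty_unitHatSlice_iso {S T : Scheme.{u}} {P' : PolarizedAbelianSchemeWithLevel g N δ T}
    {P : PolarizedAbelianSchemeWithLevel g N δ S} {f : T ⟶ S} {G : P'.A.X.left ⟶ P.A.X.left}
    {Ĝ : P'.D.hat.X.left ⟶ P.D.hat.X.left} (h : P'.IsBaseChangeVia P f G Ĝ)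
    (hP : Nonempty ((Scheme.Modules.pullback (AbelianSchemeOver.DualPair.unitHatSlice P.D)).obj P.D.P ≅
      SheafOfModules.unit _)) :
    Nonempty ((Scheme.Modules.pullback (AbelianSchemeOver.DualPair.unitHatSlice P'.D)).obj P'.D.P ≅
      SheafOfModules.unit _) := by
  obtain ⟨-, ⟨w, -, hη, -⟩, ⟨wG, wĜ, hPc⟩, -⟩ := h
  exact AbelianSchemeOver.DualPair.nonempty_unitHatSlice_iso_of_pullback_map_iso P.D P'.D wG wĜ hη hPc hP

end PolarizedAbelianSchemeWithLevel

end Literature.AlgebraicGeometry.AbelianSchemes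

end
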